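import Mathlib
import HarnessLib
import HarnessLib.Audit
import Summits.AtomisticToContinuum.Statement
import Literature.MathematicalPhysics.QuantumManyBody.PeriodicBoseGas
import HarnessLib.Audit.Status.Attr

/-!
Route: BECThomsonPrinciple

DORMANT since 2026-08-23T22:10:38Z (reconciler: no traction for 6.3 d (last activity item-evidence-added at 2026-08-17T14:46:21Z); parked, not closed — `ledger route dormant route-AtomisticToContinuum-BECThomsonPrinciple --off` to react) — unstaffed, not closed; items shared with open routes are served there. `ledger route dormant <id> --off` reactivates.

# Route BECThomsonPrinciple — Gaussian domination as a configuration-space resistance bound (one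
Thomson flow over Ψ₀²) plus KLS with the LNSS excitation operator

X = GDCan ∧ (GDCan → PeriodicBEC) ∧ (PeriodicBEC → BoseEinsteinCondensation) ("it suffices to show
X"). GDCan (CANONICAL GAUSSIAN DOMINATION ON THE
TORUS, item GaussianDominationCan): for every repulsive finite-range v and window parameter M there
are ρ₀, C, N₀ with: for N ≥ N₀ bosons
on the torus of side L at density N/L³ ≤ ρ₀, every k = 2πn/L ≠ 0 with |k| ≤ M√(N/L³), every s ≥ 0
and every periodic trial state Φ,
periodicEnergy(Φ) − 2s|⟨Φ, Λ_k† Φ⟩| ≥ E₀^per(N,L) − C s² L²/‖n‖², where Λ_k† = a_k† a_0 n̂₀^(-1/2)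
is the Lewin–Nam–Serfaty–Solovej
excitation creation operator written in configuration space (P_i = average of particle i over the
cell, n̂₀ = Σ_i P_i,
n̂₀^(-1/2) = Σ_S |S|^(-1/2) Π_(i∈S) P_i Π_(i∉S) (1−P_i)) — the ground-state energy is stiff
(transverse susceptibility ≤ 2C/k²) against
the phase source, uniformly in N and L. The route realises card thomson-flow-gaussian-domination:
GDCan is to be proved by Thomson's
principle for the ground-state Dirichlet form (ONE admissible flow on (T³)^N bounds the
susceptibility; fibre flows = crux
FibreConductance, bath charge = density channel = crux DensityResponse; their synthesis into GDCan
is the glue item GDCanOfFlows : FibreConductance → DensityResponse → GaussianDominationCan), and is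
transferred to PeriodicBEC (verbatim the crux of route
BECPeriodicReduction) by the T = 0 Kennedy–Lieb–Shastry inequality (crux GDTransfer);
PeriodicToDirichlet (the global form of BECPeriodicReduction's BoundaryTransferWeak,
stmt-AtomisticToContinuum-0827,
from which it follows by one line) gives the Dirichlet conjunct.
Lean: `open Literature.MathematicalPhysics.QuantumManyBody.BoseGas in (∀ v : ℝ → ENNReal,
IsRepulsiveFiniteRange v → ∀ M : ℝ, 0 < M → ∃ ρ₀ C : ℝ, 0 < ρ₀ ∧ 0 < C ∧ ∃ N₀ : ℕ, ∀ m : ℕ, N₀ ≤ m +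
1 → ∀ L : ℝ, 0 < L → ((m + 1 : ℕ) : ℝ) ≤ ρ₀ * L ^ 3 → ∀ n : Fin 3 → ℤ, n ≠ 0 → 2 * Real.pi * ‖(fun j
=> (n j : ℝ))‖ / L ≤ M * Real.sqrt ((m + 1 : ℕ) / L ^ 3) → ∀ s : ℝ, 0 ≤ s → ∀ Φ : PeriodicTrialState
(m + 1) L, let P : Fin (m + 1) → (Config (m + 1) → ℂ) → (Config (m + 1) → ℂ) := fun i g X => ((L ^
3)⁻¹ : ℝ) • ∫ y in cell L, g (Function.update X i y); let Q : Finset (Fin (m + 1)) → (Config (m + 1)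
→ ℂ) → (Config (m + 1) → ℂ) := fun S g => (List.finRange (m + 1)).foldr (fun i h => if i ∈ S then P
i h else h - P i h) g; let Θ : Config (m + 1) → ℂ := fun X => ∑ S ∈ (Finset.univ : Finset (Finset
(Fin (m + 1)))).filter (fun S => (0 : Fin (m + 1)) ∈ S), ((Real.sqrt (S.card : ℝ))⁻¹ : ℂ) * Q S Φ.ψ
X; periodicGroundStateEnergy v (m + 1) L + ENNReal.ofReal (s * (2 * (m + 1) * ‖∫ X in cellN (m + 1)
L, (starRingEnd ℂ) (Φ.ψ X) * Complex.exp (Complex.I * ↑(2 * Real.pi / L * ∑ j, (n j : ℝ) * X 0 j)) *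
Θ X‖)) ≤ periodicEnergy v Φ + ENNReal.ofReal (C * s ^ 2 * L ^ 2 / ‖(fun j => (n j : ℝ))‖ ^ 2)) ∧ ((∀
v : ℝ → ENNReal, IsRepulsiveFiniteRange v → ∀ M : ℝ, 0 < M → ∃ ρ₀ C : ℝ, 0 < ρ₀ ∧ 0 < C ∧ ∃ N₀ : ℕ,
∀ m : ℕ, N₀ ≤ m + 1 → ∀ L : ℝ, 0 < L → ((m + 1 : ℕ) : ℝ) ≤ ρ₀ * L ^ 3 → ∀ n : Fin 3 → ℤ, n ≠ 0 → 2 *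
Real.pi * ‖(fun j => (n j : ℝ))‖ / L ≤ M * Real.sqrt ((m + 1 : ℕ) / L ^ 3) → ∀ s : ℝ, 0 ≤ s → ∀ Φ :
PeriodicTrialState (m + 1) L, let P : Fin (m + 1) → (Config (m + 1) → ℂ) → (Config (m + 1) → ℂ) :=
fun i g X => ((L ^ 3)⁻¹ : ℝ) • ∫ y in cell L, g (Function.update X i y); let Q : Finset (Fin (m +
1)) → (Config (m + 1) → ℂ) → (Config (m + 1) → ℂ) := fun S g => (List.finRange (m + 1)).foldr (fun i
h => if i ∈ S then P i h else h - P i h) g; let Θ : Config (m + 1) → ℂ := fun X => ∑ S ∈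
(Finset.univ : Finset (Finset (Fin (m + 1)))).filter (fun S => (0 : Fin (m + 1)) ∈ S), ((Real.sqrt
(S.card : ℝ))⁻¹ : ℂ) * Q S Φ.ψ X; periodicGroundStateEnergy v (m + 1) L + ENNReal.ofReal (s * (2 *
(m + 1) * ‖∫ X in cellN (m + 1) L, (starRingEnd ℂ) (Φ.ψ X) * Complex.exp (Complex.I * ↑(2 * Real.pi
/ L * ∑ j, (n j : ℝ) * X 0 j)) * Θ X‖)) ≤ periodicEnergy v Φ + ENNReal.ofReal (C * s ^ 2 * L ^ 2 /
‖(fun j => (n j : ℝ))‖ ^ 2)) → ∀ v : ℝ → ENNReal, IsRepulsiveFiniteRange v → ∃ ρ₀ : ℝ, 0 < ρ₀ ∧ ∀ ρ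
: ℝ, 0 < ρ → ρ < ρ₀ → ∃ c : ℝ, 0 < c ∧ ∀ᶠ N : ℕ in Filter.atTop, ∃ δ : ENNReal, 0 < δ ∧ ∀ Ψ :
PeriodicTrialState N (sideLength ρ N), periodicEnergy v Ψ ≤ periodicGroundStateEnergy v N
(sideLength ρ N) + δ → ENNReal.ofReal (c * N) ≤ condensateOccupation N (sideLength ρ N) Ψ.ψ) ∧ ((∀ v
: ℝ → ENNReal, IsRepulsiveFiniteRange v → ∃ ρ₀ : ℝ, 0 < ρ₀ ∧ ∀ ρ : ℝ, 0 < ρ → ρ < ρ₀ → ∃ c : ℝ, 0 <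
c ∧ ∀ᶠ N : ℕ in Filter.atTop, ∃ δ : ENNReal, 0 < δ ∧ ∀ Ψ : PeriodicTrialState N (sideLength ρ N),
periodicEnergy v Ψ ≤ periodicGroundStateEnergy v N (sideLength ρ N) + δ → ENNReal.ofReal (c * N) ≤
condensateOccupation N (sideLength ρ N) Ψ.ψ) → _root_.BoseEinsteinCondensation)`

## Assembly
Pure logic (the deciding theorem `closes : GaussianDominationCan → GDTransfer → PeriodicToDirichlet
→ BoseEinsteinCondensation := fun hG hT hP => hP (hT hG)`, rc 0 in SketchPrinciple.lean): GDTransfer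
consumes GDCan and
yields PeriodicBEC; PeriodicToDirichlet turns PeriodicBEC into the audited Dirichlet conjunct
`_root_.BoseEinsteinCondensation`.
FibreConductance and DensityResponse do not enter the term; since the unused-crux repair
(2026-08-16) they feed its first hypothesis through the support/glue item GDCanOfFlows :
FibreConductance → DensityResponse → GaussianDominationCan (the flow mechanism's synthesis — Thomson
duality for the Λ_k-charge over Ψ₀², fibre flows + bath flow costed by the density channel — filed
as an item), so every crux lies in the cone of `closes` while GaussianDominationCan stays directly
claimable (Dyson's upper bound, needed inside GDTransfer, is the proved Literature theorem
LSSY2005_upperBound_periodic_holds); Target is rfl-equal to the conjunction of the three hypotheses,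
and the support item TargetOfCruxes (GaussianDominationCan → GDTransfer → PeriodicToDirichlet →
Target; provable now by the anonymous constructor, rc 0 in Sketch.lean, badge repair 2026-08-16)
records that glue as an item so that the target is reached inside the item graph. The item
`Assembly` itself is, since the route-choice repair 2026-08-16, the SUFFICIENCY statement
GaussianDominationCan → _root_.BoseEinsteinCondensation (canonical T = 0 Gaussian domination on the
torus implies the audited Dirichlet conjunct — "it suffices to show GDCan"): it follows from
GDTransfer and PeriodicToDirichlet by `fun hT hP hG => hP (hT hG)` (rc 0 in Sketch2.lean) and closes
when they close; its earlier tautological form GaussianDominationCan → GDTransfer →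
PeriodicToDirichlet → BEC (verbatim the type of `closes`) was flagged ground.trivial (`tauto`) by
the h21 ground audit at rev 3 and blocked READY.

Rationale: WHY THIS LINE. For a positive ground state Ψ₀ the T = 0 static susceptibility of a source A is a
dual Dirichlet norm,
χ_A = 2‖(AΨ₀)Ψ₀‖²_(H⁻¹(Ψ₀²dX)) = 2 inf ∫|J|²/Ψ₀² over flows with div J = (AΨ₀)Ψ₀ (ground-state
representation + Thomson's principle; for
one molecule this is Prager–Hirschfelder doi:10.1063/1.1734192), so the ONE inequality reflection
positivity ever supplied (Gaussian
domination: DysonLiebSimon1978, KennedyLiebShastry1988; barrier HalfFillingReflectionPositivity;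
lattice chain in-tree:
kls_xy_gaussianDomination_ground → kennedy_lieb_shastry_xy_ground) becomes an upper bound on an
effective RESISTANCE, provable the way
probabilists prove transience — exhibit one finite-energy flow (LyonsPeres2016 Ch. 2,
GrimmettKestenZhang1993) — and configuration
space gives every particle three private directions, so fibre costs add with no cross terms.
Imported area: electrical-network /
Dirichlet-form duality (potential theory, probability) with the explicit dictionary conductivity ↦
Ψ₀², charge ↦ (AΨ₀)Ψ₀, effective
resistance ↦ χ_A/2, "transience-type finiteness" ↦ GD; physically GDCan says the phase stiffness ρ_s
stays ≥ cρ at every scale up to L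
(Leggett's T = 0 variational bounds doi:10.1023/b:joss.0000033170.38619.6c are the nearest
precedent, one-body and for the opposite
inequality). Beyond the card and its two audits: (i) the source is the LNSS excitation operator Λ_k
(arXiv:1211.2778; the
Girardeau–Arnowitt / Castin–Dum number-conserving Bogoliubov operator), for which Λ†Λ = n_k exactly,
ΛΛ† = (n_k+1)1_(n₀≥1) and
[T, Λ] = −k²Λ, so KLS bounds n_k ITSELF — the card's X_k = a_k†a_0/√N only bounds ⟨n̂₀ n̂_k⟩, is
vacuous on uncondensed states, and its
clopen-in-L selection fails at the level of n₀-distributions; (ii) audit-14's hidden hypothesis is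
filed as the explicit crux
DensityResponse (the bath charge left after fibre flows is −(1/2S(k))× a density wave, not −½×) and
the circular "current trick" is
dropped; (iii) GD is typed as a chord inequality for all s ≥ 0 (large s is free since ‖Λ_k‖ ≤ √N),
uniformly down the density scale
(∀ N ≥ N₀, ∀ L with N ≤ ρ₀L³). Negatives index: empty, nothing to steer around. (This route re-files
route-AtomisticToContinuum-BECThomsonFlows and -BECThomsonDuality, retired not-a-thesis at
13:41Z/13:55Z because their Assembly concluded the defeq Literature name instead of the audited
sub-problem abbrev; here the deciding theorem `closes : GaussianDominationCan → GDTransfer →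
PeriodicToDirichlet → _root_.BoseEinsteinCondensation` (by decl names) is the two-line term fun hG
hT hP => hP (hT hG), and the item Assembly is the sufficiency statement GaussianDominationCan →
_root_.BoseEinsteinCondensation (restated at the route-choice repair 2026-08-16 from the
tautological composition of the same three names, which the h21 ground audit flags ground.trivial
via `tauto` and which blocked READY; the restated item follows from GDTransfer and
PeriodicToDirichlet by `fun hT hP hG => hP (hT hG)`, rc 0 in Sketch2.lean).)

RANKED CRUXES. #0 Target (target) — X = GDCan ∧ (GDCan → PeriodicBEC) ∧ (PeriodicBEC →
BoseEinsteinCondensation) as in § Thesis (all three inlined under a term-level `open … in`;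
rfl-equal to GaussianDominationCan ∧ GDTransfer ∧ PeriodicToDirichlet, checked in
SketchPrinciple.lean; the PeriodicBEC body is rfl-equal to BECPeriodicReduction.PeriodicBEC, checked
in SketchDedup.lean). (why it might fail: GDCan is the continuum T = 0 Gaussian-domination statement
itself (no reflection positivity is available); the transfers need Dyson's O(ρaN) upper bound, a
contact cutoff for hard cores, and a periodic→Dirichlet passage not in print.) [LSSY2005,
KennedyLiebShastry1988, DysonLiebSimon1978, arXiv:1211.2778]
#2 GaussianDominationCan (crux) — (card items F1+F2+GD_can, restated per audit-14) canonical
Gaussian domination on the torus for the LNSS excitation source, chord form: ∀ v ∀ M ∃ ρ₀ C N₀ ∀ N ≥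
N₀ ∀ L (N ≤ ρ₀L³) ∀ n ≠ 0 (2π‖n‖/L ≤ M√(N/L³)) ∀ s ≥ 0 ∀ Φ: E₀^per + s·2N|∫ conj(Φ) e^(ik·x₀) (P₀
n̂₀^(-1/2) Φ)| ≤ periodicEnergy Φ + C s² L²/‖n‖² (i.e. E₀(H + s(Λ_k^θ + Λ_k^θ†)) ≥ E₀ − C s²/k² for
every phase θ). To be proved by Thomson flows over Ψ₀²: fibre flows (FibreConductance) + bath charge
= −(1/2S(k)) × density wave (DensityResponse + the Stringari/Puff floor S(k) ≥ k/c₃) + two-phonon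
remainders. Free gas: equality with C = 1/4π² (displaced oscillator in the excitation picture);
Bogoliubov: b_Λ/2 = (u+v)²/e_k = 1/k². [difficulty: open-problem] (why it might fail: two-phonon
bath charges: crude fibre bounds give Σ_q S(q)/q⁴ ~ log(L/ξ), so L-uniformity needs their true
(stiff) H⁻¹ norms — a closure problem; hard cores need cross-fibre detours around cages; negative
v̂(k₀) kills the SHARP constant (audit-2), only C = O(1) is claimed.) [DysonLiebSimon1978,
KennedyLiebShastry1988, LSSY2005, doi:10.1063/1.1734192, arXiv:1211.2778, LyonsPeres2016]
#3 FibreConductance (crux) — (card F1, typed for bounded v and exact C¹ minimisers Φ without zeros)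
with W(X̂) = ∫|Φ(y,X̂)|²dy, ψ = |Φ|/√W (conditional amplitude of particle 0 given the bath X̂),
β(X̂) = ∫e^(ik·y)ψ(y,X̂)dy and the fibre-neutral charge q = L^(-3/2)(e^(ik·x₀)ψ − βψ²): there is a
flow J in the x₀-fibre, with weak divergence q on the torus (∫ J·∇₀η = −∫ qη for every C¹ periodic
η), such that ∫ |J|² W/ψ² ≤ C L²/‖n‖² — the bath-averaged one-body resistance of the frozen
landscape at wavelength 1/k is ≤ C/k². Free gas: J = k̂ e^(ik·x₀)ψ/(i|k|) L^(-3/2), cost exactly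
1/k². Dips of ψ are harmless (charge ∝ ψ, conductivity ∝ ψ²: the local cost is depth-independent);
only closed shells (cages) cost. [difficulty: L] (why it might fail: rare baths cage particle 0
behind shells where ψ ~ e^(−K u(0)); fibre-only flows then pay e^(+2K u(0)) and the claim needs
(probability of K-shells) × (cost) summable uniformly in N (Jastrow cluster suppression says yes,
unproved); false verbatim for hard cores, which are excluded here.) [doi:10.1063/1.1734192,
LyonsPeres2016, GrimmettKestenZhang1993, ReattoChester1967, LSSY2005]
#4 DensityResponse (crux) — (audit-14's hidden hypothesis made explicit; the same statement as card
kv-insertion-corrector's K1 StaticResponseBound) density-channel chord bound at compressibility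
level: ∀ v ∀ M ∃ ρ₀ C N₀ ∀ N ≥ N₀ ∀ L (N ≤ ρ₀L³) ∀ n ≠ 0 in the window ∀ s ≥ 0 ∀ Φ: E₀^per + s|∫
(Σ_i 2cos(k·x_i))|Φ|²| ≤ periodicEnergy Φ + C s² N/(k² + (N/L³)·a), a = scattering length of v
(toReal; 0 for v = 0, where the free value χ/N = 2/k² shows the form is sharp); i.e. χ_ρρ(k) ≤
2CN/(k² + ρa) — Feynman single-mode saturation up to constants (Bogoliubov: 2N/(k² + 16πρa)),
uniformly down to k = 2π/L. [difficulty: open-problem] (why it might fail: a chord bound down to s →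
0 is a true curvature bound: LHY-precision asymptotics control E₀(s) only for s ≳ ρa(ρa³)^(1/4) and
concavity does not propagate below, so anomalously soft low-k density weight (no Landau-type floor
is known in the thermodynamic limit) is excluded by no printed method.) [FournaisSolovej2020,
Feynman1954, PitaevskiiStringari1991, Stringari1995, LSSY2005]
#5 GDTransfer (crux) — GDCan → PeriodicBEC (PeriodicBEC verbatim = BECPeriodicReduction.PeriodicBEC;
GDCan inlined as the antecedent). Mechanism: T = 0 Kennedy–Lieb–Shastry run variationally with Φ_t =
Ψ + tζ, ζ = (Λ_k^θ + Λ_k^θ†)Ψ, for a δ-near-minimiser Ψ: GDCan at (s,t) with s = t‖ζ‖²k²/C gives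
‖ζ‖⁴ ≤ C c_k/k², c_k = second variation of the energy form at ζ ≤ 2(k² + C'ρ), while ‖ζ‖² ≥ ⟨Ψ, n̂_k
Ψ⟩ (Λ†Λ = n̂_k); hence n_k ≤ √(2C)(1 + √(C'ρ)/k) in the window, Σ_window n_k = O(√C M³ √ρ N),
kinetic Chebyshev above the window Σ_(|k|>M√ρ) n_k ≤ (E₀+δ)/(M²ρ) ≤ 4πaN(1+o(1))/M² (Dyson's bound =
the PROVED Literature theorem LSSY2005_upperBound_periodic_holds of
Literature.MathematicalPhysics.QuantumManyBody.PeriodicBoseGasUpperBoundProofs — import that module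
in the Theorems file; the former support item UpperBoundPeriodic was dropped at route-repair g2 as
moot), Parseval on the cell ⇒ ⟨Ψ, n̂₀Ψ⟩ ≥ (1 − 4πa/M² − O(M³√(ρa³)))N; choose M then ρ₀. [deps:
GaussianDominationCan] [difficulty: L] (why it might fail: for hard cores the bare ζ has infinite
energy (c_k = ∞): needs a contact cutoff F with ⟨ζ,(1−F)ζ⟩ = O(ρa³)‖ζ‖² and finite c_F;
near-minimisers are not eigenstates (first-variation errors O(√δ), momentum not sharp); 3-D Parseval
on the cell and Dyson's upper bound are not in Mathlib.) [KennedyLiebShastry1988, KLS1988JSP,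
PitaevskiiStringari1991, arXiv:1211.2778, LSSY2005, Fournais2020]
#6 PeriodicToDirichlet (crux) — (global form of route BECPeriodicReduction's BoundaryTransferWeak =
stmt-AtomisticToContinuum-0827, from which it follows by `fun h hP v hv => h v hv (hP v hv)`; filed
as this route's own decl so that the deciding theorem `closes` can name it) PeriodicBEC ⇒
BoseEinsteinCondensation: if for every repulsive finite-range v the δ-near-minimisers of the
PERIODIC energy on the torus of side (N/ρ)^(1/3) have constant-mode occupation ≥ cN at all small
densities (the consequent of GDTransfer, verbatim), then the audited Dirichlet, mode-free conjunct
holds (λ_max of γ of the Dirichlet ground state ≥ cN via condensateNumber, all small ρ, every such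
v). [deps: GDTransfer] [difficulty: L] (why it might fail: Dirichlet and periodic ground-state
energies differ by a wall term far above the near-minimiser slack, so no energy-comparison proof
exists; needs Neumann bracketing of interior boxes plus a mode-free criterion (λ_max ≥ tr γ²/N); BEC
can be boundary-condition sensitive (Robinson 1976).) [LSSY2005, BoccatoSeiringer2023, Junge2026,
doi:10.1007/bf01608554]
#9 TargetOfCruxes (support) — glue to the target: GaussianDominationCan → GDTransfer →
PeriodicToDirichlet → Target (Target is syntactically the conjunction of the three crux bodies under
`open … in`; the term `fun hG hT hP => ⟨hG, hT, hP⟩` closes it, rc 0 in Sketch.lean). Filed at the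
badge repair 2026-08-16 so that an item concludes Target (gate stamp route.target-unreachable); it
carries no mathematics and does not enter `closes`. [deps: GaussianDominationCan, GDTransfer,
PeriodicToDirichlet] [difficulty: provable-now]
#9 GDCanOfFlows (support) — glue of the flow mechanism (unused-crux repair 2026-08-16):
FibreConductance → DensityResponse → GaussianDominationCan — the thesis' recipe filed as an item so
that both mechanism cruxes feed the `closes` hypothesis GaussianDominationCan (which stays directly
claimable; `closes` unchanged). Content, for an exact positive minimiser Ψ₀ at fixed (N, L) and k in
the window: (i) ground-state representation + Thomson duality, χ_Λ/2 = ‖(Λ_kΨ₀)Ψ₀‖²_(H⁻¹(Ψ₀²)) ≤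
∫|J|²/Ψ₀² for ONE flow J with div J = the Λ_k-charge; (ii) J = the fibre flows of FibreConductance
(re-weighted from the charge e^(ik·x₀)ψ to the Λ_k-charge, coefficients P_i n̂₀^(-1/2)Ψ₀) plus a
bath flow for the fibre-averaged residual charge −(1−S(k))/(2S(k)N)·ρ_kΨ₀² + two-phonon remainder,
costed by DensityResponse (χ_ρρ(k) ≤ 2CN/(k² + ρa)) and the moment floor S(k) ≥ k/c₃ (m₃ finite for
smooth v); (iii) from the curvature bound at s = 0 to the chord inequality for every s ≥ 0 and every
trial Φ (large s free, ‖Λ_k‖ ≤ √N); (iv) existence of exact zero-free minimisers for bounded v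
(compact resolvent + positivity improvement on the torus), without which FibreConductance cannot be
invoked; (v) bounded → hard-core v by monotone truncation v_n ↑ v. [deps: FibreConductance,
DensityResponse] [difficulty: XL] (why it might fail: heavy for a glue — (ii) contains
GaussianDominationCan's own two-phonon closure problem (crude fibre bounds give Σ_q S(q)/q⁴ ~
log(L/ξ)); (v) is not fed by the hypotheses (FibreConductance is bounded-v only and both hypotheses'
constants ρ₀, C, N₀ depend on v with no uniformity along v_n ↑ v), so v-uniform versions must ride
as --supports lemmas; (iii) is an operator inequality |⟨B⟩_Φ|² ≤ (4C/k²)⟨H − E₀⟩_Φ‖Φ‖², stronger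
than second-order perturbation theory; if FibreConductance is ever refuted the item is vacuously
true and is dropped with it.) [doi:10.1063/1.1734192, LyonsPeres2016, DysonLiebSimon1978,
KennedyLiebShastry1988, PitaevskiiStringari1991, Stringari1995, arXiv:1211.2778, LSSY2005,
ReedSimonIV1978]

TWO-LAYER PLAN. Since the unused-crux repair (2026-08-16) the flow synthesis is ONE unsplit glue
item, GDCanOfFlows : FibreConductance → DensityResponse → GaussianDominationCan (support, layer 1;
no children filed); the foreseen glued split it stands in for remains: GaussianDominationCan ⇐
FibreStep → BathStep → GaussianDominationCan, where FibreStep =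
FibreConductance extended to the Λ-charge (coefficients P_i n̂₀^(-1/2)Ψ₀ instead of P_iΨ₀) and
BathStep = "the fibre-averaged bath
charge has H⁻¹(Ψ₀²) norm ≤ C/k² given DensityResponse" (regression on ρ_k with coefficient
−(1−S)/(2SN) plus a two-phonon remainder),
once the ground-state Dirichlet-form vocabulary lands (definition request); GDTransfer ⇐
KLSVariational → ModeCounting → GDTransfer
(KLS for bounded sources over PeriodicTrialState; Parseval + kinetic Chebyshev + Dyson);
DensityResponse ⇐ high-k (Neumann
localisation to Fournais boxes, facts Fournais2020 / Junge2026) → low-k (LDA against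
FournaisSolovej2020) for s above the precision
threshold only — the s → 0 part stays the crux.

KILL CRITERIA. ¬GaussianDominationCan for some admissible v at arbitrarily small density (a
transverse susceptibility ≫ 1/k² at k ~ 2π/L, i.e. phase
stiffness → 0 at large scales) closes the route (close --reason refuted:GaussianDominationCan) and
physically T = 0 superfluidity;
¬DensityResponse (soft density weight at low k) forces a pivot to a Landau-conditional bridge (card
sector-gap-no-cheap-momentum) but
does not kill GDCan; ¬FibreConductance for bounded v kills the flow MECHANISM (route becomes
hypothesis-only: supersede by a
continuum-gaussian-domination route if one is open); PeriodicBEC proved elsewhere moots cruxes 2–5;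
¬PeriodicToDirichlet (equivalently ¬BoundaryTransferWeak of BECPeriodicReduction) kills this
route and every periodic-first route alike (not the conjunct). ¬GDCanOfFlows is not expected (it
would need both mechanism cruxes true and GDCan false — superfluid-stiffness failure WITH good fibre
conductance and compressibility); if FibreConductance or DensityResponse is refuted, GDCanOfFlows
turns vacuous and is dropped in the same repair (GaussianDominationCan stays, directly claimable).

NOT DECOMPOSED YET. The H⁻¹(Ψ₀²)/Thomson identity itself (needs the exact ground state as an object:
definition request), the floor S(k) ≥ k/c₃
(Stringari/Puff moment inequality; known, support-level, m₃ finite only for smooth v), the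
two-phonon remainder bound, the contact
cutoff for hard cores, Parseval on the 3-D cell, the dependence of constants on v (needed to reach
hard cores by monotone truncation
v_n ↑ v) — all layer-2 children or prover lemmas (`--supports`); until then they sit inside the glue
item GDCanOfFlows, whose informal text lists them as steps (i)–(v).

CHEAPEST FALSIFIER. (a) Jastrow-level numerics (kit, hours): with Ψ₀ = McMillan–Reatto Jastrow at
ρa³ = 10⁻³ regress the conditional Fourier coefficient
Ψ̂₀^(i)(k;X̂) on ρ_k(X̂): the coefficient must be −(1−S(k))/(2S(k)N) within 20% and the regression
residual's fibre-free H⁻¹ proxy must be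
o(1/k²)-compatible — a coefficient of modulus ≥ 1/(S(k)N) or a residual ∝ 1/k³ retires the flow
mechanism; (b) paper check done here,
consistent: in Bogoliubov theory b_Λ/2 = (u+v)²/e_k = 1/k² exactly and χ_ρρ/N = 2/(k² + 16πρa), so
GaussianDominationCan (C ≥ 1) and
DensityResponse (C ≥ 2) hold at that level; (c) closed-form 1-D Tonks check (Ψ₀ = Π|sin|):
FibreConductance must FAIL there (cages)
while the window count diverges — if instead FibreConductance held in 1-D the mechanism would prove
too much.

NUMBERS. Bogoliubov values (units ħ = 2m = 1): e_k = √(k⁴ + 16πρa k²), c = 4√(πρa), ξ =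
(8πρa)^(-1/2), S(k) = k²/e_k, (u−v)² = k²/e_k,
(u+v)² = e_k/k²; transverse susceptibility b/2 = 1/k² (phase quadrature) and k²/e_k² ≤ 1/k² (density
quadrature); χ_ρρ(k)/N =
2/(k² + 16πρa); n_k → c/(4k) for kξ ≪ 1; KLS output n_k ≤ √(2C)(1 + √(C'ρ)/k); window #modes
(4π/3)(M√ρ L/2π)³ = M³√ρ N/(6π²)
(M carries units length^(1/2), M = M'√a gives O(M'³√(ρa³))N); kinetic tail ≤ 4πaN(1+o(1))/M²;
Josephson: exact b/2 → (n₀/ρ_s-type)(1/k²)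
at k → 0 with ρ_s = ρ at T = 0. Items at open: 8; after route-repair g2 (2026-08-15): 7 (support
UpperBoundPeriodic dropped — its fact is proved in tree); after the badge repair (2026-08-16): 8
(support TargetOfCruxes added; cruxes still 5, one assembly, one target). After the route-choice
repair (2026-08-16, gate stamp route.target-unreachable, option (a)): still 8 — item Assembly
restated 1:1 to GaussianDominationCan → _root_.BoseEinsteinCondensation (new item id, same decl name
and kind); cruxes still 5 with why/sources, one target, one support TargetOfCruxes concluding the
target. After the unused-crux repair (2026-08-16): 9 — support/glue GDCanOfFlows : FibreConductance
→ DensityResponse → GaussianDominationCan added (lean check rc 0 with the route file; ground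
battery: no flags), so all five cruxes lie in the cone of `closes` (GaussianDominationCan,
GDTransfer, PeriodicToDirichlet as hypotheses; FibreConductance, DensityResponse through
GDCanOfFlows); cruxes still 5, one target, one assembly, two supports (TargetOfCruxes proved).

DEFINITION REQUESTS. - GroundStateDirichletForm / weighted H⁻¹ norm on Config N over the density of
an exact minimiser (topic
  Literature/MathematicalPhysics/QuantumManyBody): E_w(F) = ∫|∇F|²w, ‖q‖²_(H⁻¹(w)) = sup_F (2Re∫
conj(F) q − E_w(F)) = inf ∫|J|²/w over
  div J = q (Thomson), and the identity χ_A = 2‖(AΨ₀)Ψ₀‖²_(H⁻¹(Ψ₀²)) for bounded A — wanted for the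
layer-2 split of GaussianDominationCan.
- ExcitationMap (Lewin–Nam–Serfaty–Solovej U_N; configuration-space form of a_k, a_k† on the N-body
torus:
  Λ_k† = Σ_i e^(ik·x_i) P_i ∘ n̂₀^(-1/2)) — would replace GaussianDominationCan's inline lets by one
Literature constant.
- Cite facts wanted as hypotheses: none. LSSY2005_upperBound_periodic (LSSY2005 Thm 2.2, Dyson's
upper bound) is PROVED in tree (LSSY2005_upperBound_periodic_holds,
PeriodicBoseGasUpperBoundProofs.lean; axioms propext/Classical.choice/Quot.sound, re-verified by
route-repair g2) and is used by GDTransfer provers as a library theorem, not as an item; the other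
three facts of the imported module PeriodicBoseGas (Fournais2020_condensation,
LSSY2005_lowerBound_periodic, LSSY2005_lowerBound_dirichlet) are proved too and are not used by any
item. CONE (route-repair g1 14:15Z + g2): the import cone's remaining unproved 0-binder propositions
are exactly the four Literature conjunct heads (KineticTheory.HydrodynamicLimit,
HeatConduction.FouriersLaw, StatisticalMechanics.Crystallization, BoseGas.BoseEinsteinCondensation =
this route's target) entering through the hard-wired Statement imports; none is a hypothesis of any
decl here and none can be dropped by the route; every other closed fact in the 18-module cone (61)
carries a clean witness in tree.

Novelty: Searches (2026-08-15): lit frontier AtomisticToContinuum --since 2020 (30 rows; BEC descendants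
arXiv:2603.20776, arXiv:2510.20493,
arXiv:2602.16566 — none on GD/flows); lit bridges AtomisticToContinuum --cross any (0 relevant); lit
search --source crossref ×4
("Gaussian domination interacting Bose gas continuum…": doi:10.1142/s0217979299002988,
doi:10.1007/978-3-0348-8018-3_5,
doi:10.1016/j.physleta.2013.08.045; "variational upper bound polarizability Thomson Prager
Hirschfelder": doi:10.1063/1.1734192,
doi:10.1063/1.1695770, doi:10.1016/0009-2614(71)80238-5; "Leggett superfluid fraction T=0 bounds":
doi:10.1023/b:joss.0000033170.38619.6c
(paywalled, acq-01700); "number-conserving Bogoliubov Castin Dum Girardeau":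
doi:10.1103/physreva.58.775, doi:10.1063/1.4881536);
lit search --hybrid local (8 docs, textbooks only); lit galaxy search "Gaussian domination" --star
all (18 rows, all RP/lattice:
Friedli–Velenik, LSSY2005 Ch. 11, Tasaki, Peled–Spinka); openalex/arxiv HTTP 429 this hour, zbmath
0; plus the card's two audits
(crossref ×4, hybrid ×3, galaxy ×9, 4 reads).
Nearest prior art found: doi:10.1063/1.1734192 Prager–Hirschfelder 1963 (second-order energy =
electrostatic energy of the charge
ψ₀(V−E₁)ψ₀ in the dielectric ψ₀²; trial fields give upper bounds — one molecule, no N- or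
L-uniformity); doi:10.1023/b:joss.0000033170.38619.6c
Leggett 1998 (variational upper/lower bounds on ρ_s at T = 0 from the one-body density);
DysonLiebSimon1978 / KennedyLiebShastry1988
(GD ⇒ IR ⇒  [refs: 10.1142/s0217979299002988, 10.1007/978-3-0348-8018-3_5, 10.1016/j.physleta.2013.08.045, 10.1063/1.1734192, 10.1063/1.1695770, 10.1016/0009-2614(71, 10.1023/b:joss.0000033170.38619.6c, 10.1103/physreva.58.775, 10.1063/1.4881536, 2603.20776, 2510.20493, 2602.16566, 1211.2778, doi:10.1142/s0217979299002988, doi:10.1007/978-3-0348-8018-3_5, doi:10.1016/j.physleta.2013.08.045, doi:10.1063/1.1734192, do]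

Barriers (technique_class: Gaussian-domination, thomson-duality, infrared-bound): - technique_class: Gaussian-domination, thomson-duality, infrared-bound
- Literature.Barriers.AtomisticToContinuum.HalfFillingReflectionPositivity: attacked head-on — GD is
sought from the dual (Thomson) variational principle of the ground-state Dirichlet form, which needs
Ψ₀ > 0 (any repulsive v) but no reflection, lattice or half filling; honest: GaussianDominationCan
is open; the bet is that flows tolerate O(1) sloppiness where RP gives identities.
- Literature.Barriers.AtomisticToContinuum.KineticGapLengthScales: evaded — no (box side)² × (excess
energy) bookkeeping anywhere; L-uniformity is asked of a resistance bound and of DensityResponse;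
the gap method may enter only DensityResponse's high-k layer-2 child on Fournais boxes ℓ ≪ L, where
it is legitimate.
- Literature.Barriers.AtomisticToContinuum.EnergyAsymptoticsWithoutCondensation: respected — energy
asymptotics of H alone are never used to infer BEC; DensityResponse is a response bound for a
perturbed family (the entry's listed evasion) and its why-might-fail records exactly where LHY
precision stops (s → 0).
- Literature.Barriers.AtomisticToContinuum.BogoliubovPerturbationInfrared: evaded — no expansion
around the Bogoliubov state; the d = 3 logarithms can resurface only as the two-phonon closure
problem flagged in GaussianDominationCan's why-might-fail, not as a divergent series.
- Literature.Barriers.AtomisticToContinuum.PitaevskiiStringariOneDimension: consistent — KLS and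
sum-rule inequalities are dimension-fr

Novelty grade: new-combination — route-review grade (refuter-rreview-0815T13-25-0): NEW-COMBINATION. Nearest prior art: Prager–Hirschfelder 1963 doi:10.1063/1.1734192 (2nd-order energy = Thomson/electrostatic energy of the charge ψ₀(V−E₁)ψ₀ in the dielectric ψ₀²; one molecule, no N/L-uniformity); DysonLiebSimon1978 + KennedyLiebSha (refuter refuter-rreview-0815T13-25-0, 2026-08-15T14:51:15Z; prior: doi:10.1063/1.1734192,KennedyLiebShastry1988,DysonLiebSimon1978,arXiv:1211.2778,doi:10.1023/b:joss.0000033170.38619.6c)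

History (route lifecycle, newest last):
- 2026-08-15T16:43:07Z · rev 2: dropped UpperBoundPeriodic — route-repair g2 (cone guardrail, rrepair-AtomisticToContinuum-BECThomso-33df1b0d-g2): NEEDED FACTS: none; 0 imports droppable (PeriodicBoseGas is vocabulary: pe (planner-rrepair-AtomisticToContinuum-BECThomso-33df1b0d-g2-0)
- 2026-08-16T03:28:33Z · rev 4: restated Assembly (stmt-AtomisticToContinuum-9485) — route-choice repair (rchoice-AtomisticToContinuum-BECThomso-4051dc8c, stamp route.target-unreachable, option (a)): glue-to-target support item TargetOfCruxes : (planner-rchoice-AtomisticToContinuum-BECThomso-4051dc8c-0)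
- 2026-08-16T03:37:12Z · rev 5: restated Assembly (stmt-AtomisticToContinuum-14474) — route-repair (ground-failed, unit rground-AtomisticToContinuum-BECThomson-33df1b0d): restate the ONLY blocking item, Assembly (stmt-AtomisticToContinuum-9485, g (planner-rground-AtomisticToContinuum-BECThomson-33df1b0d-0)
- 2026-08-16T03:46:15Z · rev 5: restated Assembly (stmt-AtomisticToContinuum-14591) — route-repair (ground-failed, unit rground-AtomisticToContinuum-BECThomson-33df1b0d) — COLLISION FIX + resync: my 03:37:12Z restate of Assembly (→ stmt-14591 `Ta (planner-rground-AtomisticToContinuum-BECThomson-33df1b0d-0)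
- 2026-08-23T22:10:38Z · DORMANT — reconciler: no traction for 6.3 d (last activity item-evidence-added at 2026-08-17T14:46:21Z); parked, not closed — `ledger route dormant route-AtomisticToConti (operator:999:1776616)

sub-problem: BoseEinsteinCondensation · status: dormant · opened planner-plancard-AtomisticToContinuum-BoseEin-e92e37bd-0 2026-08-15T13:58:17Z · rev 6 · ledger route-AtomisticToContinuum-BECThomsonPrinciple
GENERATED by the gate from the ledger (D-0016/17). Provers cite these decls: `theorem foo : Summit.AtomisticToContinuum.BoseEinsteinCondensation.Theses.BECThomsonPrinciple.<Decl> := …` in Summits/AtomisticToContinuum/BoseEinsteinCondensation/Theorems/<Name>.lean.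
-/

namespace Summit.AtomisticToContinuum.BoseEinsteinCondensation.Theses.BECThomsonPrinciple

open scoped BigOperators Topology Manifold Classical MeasureTheory ProbabilityTheory Matrix InnerProductSpace ComplexConjugate ContinuousMap
open Filter Set Function TopologicalSpace MeasureTheory

attribute [summit_statement] _root_.BoseEinsteinCondensation

/-- item stmt-AtomisticToContinuum-9478 · target · rank 0 · open · by planner
why it might fail: X = GDCan ∧ (GDCan→PeriodicBEC) ∧ (PeriodicBEC→BEC): GDCan is continuum T=0 Gaussian domination itself (open; no reflection positivity off the lattice); the KLS transfer is silent for hard cores without an unprinted contact cutoff; the periodic→Dirichlet passage (= shared open 0827) is in no print.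
sources: LSSY2005, KennedyLiebShastry1988, DysonLiebSimon1978, arXiv:1211.2778, arXiv:2510.20493
[target] X = GDCan ∧ (GDCan → PeriodicBEC) ∧ (PeriodicBEC → BoseEinsteinCondensation) as in § Thesis
(all three inlined under a term-level `open … in`; rfl-equal to GaussianDominationCan ∧ GDTransfer ∧
PeriodicToDirichlet, checked in SketchPrinciple.lean; the PeriodicBEC body is rfl-equal to
BECPeriodicReduction.PeriodicBEC, checked in SketchDedup.lean). -/
@[route_item "route-AtomisticToContinuum-BECThomsonPrinciple"]
def Target : Prop :=
  open Literature.MathematicalPhysics.QuantumManyBody.BoseGas in (∀ v : ℝ → ENNReal, IsRepulsiveFiniteRange v → ∀ M : ℝ, 0 < M → ∃ ρ₀ C : ℝ, 0 < ρ₀ ∧ 0 < C ∧ ∃ N₀ : ℕ, ∀ m : ℕ, N₀ ≤ m + 1 → ∀ L : ℝ, 0 < L → ((m + 1 : ℕ) : ℝ) ≤ ρ₀ * L ^ 3 → ∀ n : Fin 3 → ℤ, n ≠ 0 → 2 * Real.pi * ‖(fun j => (n j : ℝ))‖ / L ≤ M * Real.sqrt ((m + 1 : ℕ) / L ^ 3)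 → ∀ s : ℝ, 0 ≤ s → ∀ Φ : PeriodicTrialState (m + 1) L, let P : Fin (m + 1) → (Config (m + 1) → ℂ) → (Config (m + 1) → ℂ) := fun i g X => ((L ^ 3)⁻¹ : ℝ) • ∫ y in cell L, g (Function.update X i y); let Q : Finset (Fin (m + 1)) → (Config (m + 1) → ℂ) → (Config (m + 1) → ℂ) := fun S g => (List.finRange (m + 1)).foldr (fun i h => if i ∈ S then P i h else h - P i h) g; let Θ : Config (m + 1) → ℂ := fun X => ∑ S ∈ (Finset.univ : Finset (Finset (Fin (m + 1)))).filter (fun S => (0 : Fin (m + 1)) ∈ S), ((Real.sqrt (S.card : ℝ))⁻¹ : ℂ) * Q S Φ.ψ X; periodicGroundStateEnergy v (m + 1) L + ENNReal.ofReal (s * (2 * (m + 1) * ‖∫ X in cellN (m + 1) L, (starRingEnd ℂ) (Φ.ψ X) * Complex.exp (Complex.I * ↑(2 * Real.pi / L * ∑ j, (n j : ℝ) * X 0 j)) * Θ X‖)) ≤ periodicEnergy v Φ + ENNReal.ofReal (C * s ^ 2 * L ^ 2 / ‖(fun j => (n j : ℝ))‖ ^ 2)) ∧ ((∀ v : ℝ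 → ENNReal, IsRepulsiveFiniteRange v → ∀ M : ℝ, 0 < M → ∃ ρ₀ C : ℝ, 0 < ρ₀ ∧ 0 < C ∧ ∃ N₀ : ℕ, ∀ m : ℕ, N₀ ≤ m + 1 → ∀ L : ℝ, 0 < L → ((m + 1 : ℕ) : ℝ) ≤ ρ₀ * L ^ 3 → ∀ n : Fin 3 → ℤ, n ≠ 0 → 2 * Real.pi * ‖(fun j => (n j : ℝ))‖ / L ≤ M * Real.sqrt ((m + 1 : ℕ) / L ^ 3) → ∀ s : ℝ, 0 ≤ s → ∀ Φ : PeriodicTrialState (m + 1) L, let P : Fin (m + 1) → (Config (m + 1) → ℂ) → (Config (m + 1) → ℂ) := fun i g X => ((L ^ 3)⁻¹ : ℝ) • ∫ y in cell L, g (Function.update X i y); let Q : Finset (Fin (m + 1)) → (Config (m + 1) → ℂ) → (Config (m + 1) → ℂ) := fun S g => (List.finRange (m + 1)).foldr (fun i h => if i ∈ S then P i h else h - P i h) g; let Θ : Config (m + 1) → ℂ := fun X => ∑ S ∈ (Finset.univ : Finset (Finset (Fin (m + 1)))).filter (fun S => (0 : Fin (m + 1)) ∈ S), ((Real.sqrt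 (S.card : ℝ))⁻¹ : ℂ) * Q S Φ.ψ X; periodicGroundStateEnergy v (m + 1) L + ENNReal.ofReal (s * (2 * (m + 1) * ‖∫ X in cellN (m + 1) L, (starRingEnd ℂ) (Φ.ψ X) * Complex.exp (Complex.I * ↑(2 * Real.pi / L * ∑ j, (n j : ℝ) * X 0 j)) * Θ X‖)) ≤ periodicEnergy v Φ + ENNReal.ofReal (C * s ^ 2 * L ^ 2 / ‖(fun j => (n j : ℝ))‖ ^ 2)) → ∀ v : ℝ → ENNReal, IsRepulsiveFiniteRange v → ∃ ρ₀ : ℝ, 0 < ρ₀ ∧ ∀ ρ : ℝ, 0 < ρ → ρ < ρ₀ → ∃ c : ℝ, 0 < c ∧ ∀ᶠ N : ℕ in Filter.atTop, ∃ δ : ENNReal, 0 < δ ∧ ∀ Ψ : PeriodicTrialState N (sideLength ρ N), periodicEnergy v Ψ ≤ periodicGroundStateEnergy v N (sideLength ρ N) + δ → ENNReal.ofReal (c * N) ≤ condensateOccupation N (sideLength ρ N) Ψ.ψ) ∧ ((∀ v : ℝ → ENNReal, IsRepulsiveFiniteRange v → ∃ ρ₀ : ℝ, 0 < ρ₀ ∧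 ∀ ρ : ℝ, 0 < ρ → ρ < ρ₀ → ∃ c : ℝ, 0 < c ∧ ∀ᶠ N : ℕ in Filter.atTop, ∃ δ : ENNReal, 0 < δ ∧ ∀ Ψ : PeriodicTrialState N (sideLength ρ N), periodicEnergy v Ψ ≤ periodicGroundStateEnergy v N (sideLength ρ N) + δ → ENNReal.ofReal (c * N) ≤ condensateOccupation N (sideLength ρ N) Ψ.ψ) → _root_.BoseEinsteinCondensation)

/-- item stmt-AtomisticToContinuum-9479 · crux · rank 2 · open · by planner
why it might fail: No RP in the continuum: GDCan asserts L-uniform phase stiffness (Josephson: exact b/2 → (n₀/ρ_s)/k², so it needs ρ_s ≥ cρ at every scale ≤ L — T=0 superfluidity, unproved for any admissible v≠0); two-phonon bath charges give Σ_q S(q)/q⁴ ~ log(L/ξ) unless true H⁻¹ norms enter; hard cores need detours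
sources: DysonLiebSimon1978, KennedyLiebShastry1988, GavoretNozieres1964, PitaevskiiStringari1991, LSSY2005, arXiv:1211.2778
[crux] (card items F1+F2+GD_can, restated per audit-14) canonical Gaussian domination on the torus
for the LNSS excitation source, chord form: ∀ v ∀ M ∃ ρ₀ C N₀ ∀ N ≥ N₀ ∀ L (N ≤ ρ₀L³) ∀ n ≠ 0
(2π‖n‖/L ≤ M√(N/L³)) ∀ s ≥ 0 ∀ Φ: E₀^per + s·2N|∫ conj(Φ) e^(ik·x₀) (P₀ n̂₀^(-1/2) Φ)| ≤
periodicEnergy Φ + C s² L²/‖n‖² (i.e. E₀(H + s(Λ_k^θ + Λ_k^θ†)) ≥ E₀ − C s²/k² for every phase θ).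
To be proved by Thomson flows over Ψ₀²: fibre flows (FibreConductance) + bath charge = −(1/2S(k)) ×
density wave (DensityResponse + the Stringari/Puff floor S(k) ≥ k/c₃) + two-phonon remainders. Free
gas: equality with C = 1/4π² (displaced oscillator in the excitation picture); Bogoliubov: b_Λ/2 =
(u+v)²/e_k = 1/k². [difficulty: open-problem] -/
@[route_item "route-AtomisticToContinuum-BECThomsonPrinciple", crux]
def GaussianDominationCan : Prop :=
  ∀ v : ℝ → ENNReal, Literature.MathematicalPhysics.QuantumManyBody.BoseGas.IsRepulsiveFiniteRange v → ∀ M : ℝ, 0 < M → ∃ ρ₀ C : ℝ, 0 < ρ₀ ∧ 0 < C ∧ ∃ N₀ : ℕ, ∀ m : ℕ, N₀ ≤ m + 1 → ∀ L : ℝ, 0 < L → ((m + 1 : ℕ) : ℝ) ≤ ρ₀ * L ^ 3 → ∀ n : Fin 3 → ℤ, n ≠ 0 → 2 * Real.pi * ‖(fun j => (n j : ℝ))‖ / L ≤ M * Real.sqrt ((m + 1 : ℕ) / L ^ 3) → ∀ s : ℝ, 0 ≤ s → ∀ Φ : Literature.MathematicalPhysics.QuantumManyBody.BoseGas.PeriodicTrialState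 (m + 1) L, let P : Fin (m + 1) → (Literature.MathematicalPhysics.QuantumManyBody.BoseGas.Config (m + 1) → ℂ) → (Literature.MathematicalPhysics.QuantumManyBody.BoseGas.Config (m + 1) → ℂ) := fun i g X => ((L ^ 3)⁻¹ : ℝ) • ∫ y in Literature.MathematicalPhysics.QuantumManyBody.BoseGas.cell L, g (Function.update X i y); let Q : Finset (Fin (m + 1)) → (Literature.MathematicalPhysics.QuantumManyBody.BoseGas.Config (m + 1) → ℂ) → (Literature.MathematicalPhysics.QuantumManyBody.BoseGas.Config (m + 1) → ℂ) := fun S g => (List.finRange (m + 1)).foldr (fun i h => if i ∈ S then P i h else h - P i h) g; let Θ : Literature.MathematicalPhysics.QuantumManyBody.BoseGas.Config (m + 1) → ℂ := fun X => ∑ S ∈ (Finset.univ : Finset (Finset (Fin (m + 1)))).filter (fun S => (0 : Fin (m + 1)) ∈ S), ((Real.sqrt (S.card : ℝ))⁻¹ : ℂ) * Q S Φ.ψ X; Literature.MathematicalPhysics.QuantumManyBody.BoseGas.periodicGroundStateEnergy v (m + 1) L + ENNReal.ofReal (s * (2 * (m + 1) * ‖∫ X in Literature.MathematicalPhysics.QuantumManyBody.BoseGas.cellN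 (m + 1) L, (starRingEnd ℂ) (Φ.ψ X) * Complex.exp (Complex.I * ↑(2 * Real.pi / L * ∑ j, (n j : ℝ) * X 0 j)) * Θ X‖)) ≤ Literature.MathematicalPhysics.QuantumManyBody.BoseGas.periodicEnergy v Φ + ENNReal.ofReal (C * s ^ 2 * L ^ 2 / ‖(fun j => (n j : ℝ))‖ ^ 2)

/-- item stmt-AtomisticToContinuum-9480 · crux · rank 3 · open · by planner
why it might fail: Caging: rare baths enclose particle 0 in a shell where ψ ~ e^{-Ku}; fibre-only flows pay e^{+2Ku}, and (shell probability)×(cost) must be summable uniformly in N — no N-uniform one-variable Harnack bound for Ψ₀ (‖V‖∞ ~ N), Jastrow cluster suppression unproved; false verbatim for hard cores; excluded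
sources: doi:10.1063/1.1734192, LyonsPeres2016, GrimmettKestenZhang1993, ReattoChester1967, LSSY2005
[crux] (card F1, typed for bounded v and exact C¹ minimisers Φ without zeros) with W(X̂) =
∫|Φ(y,X̂)|²dy, ψ = |Φ|/√W (conditional amplitude of particle 0 given the bath X̂), β(X̂) =
∫e^(ik·y)ψ(y,X̂)dy and the fibre-neutral charge q = L^(-3/2)(e^(ik·x₀)ψ − βψ²): there is a flow J in
the x₀-fibre, with weak divergence q on the torus (∫ J·∇₀η = −∫ qη for every C¹ periodic η), such
that ∫ |J|² W/ψ² ≤ C L²/‖n‖² — the bath-averaged one-body resistance of the frozen landscape at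
wavelength 1/k is ≤ C/k². Free gas: J = k̂ e^(ik·x₀)ψ/(i|k|) L^(-3/2), cost exactly 1/k². Dips of ψ
are harmless (charge ∝ ψ, conductivity ∝ ψ²: the local cost is depth-independent); only closed
shells (cages) cost. [difficulty: L] -/
@[route_item "route-AtomisticToContinuum-BECThomsonPrinciple"]
def FibreConductance : Prop :=
  ∀ v : ℝ → ENNReal, Literature.MathematicalPhysics.QuantumManyBody.BoseGas.IsRepulsiveFiniteRange v → (∃ B : ℝ, ∀ r, v r ≤ ENNReal.ofReal B) → ∀ M : ℝ, 0 < M → ∃ ρ₀ C : ℝ, 0 < ρ₀ ∧ 0 < C ∧ ∃ N₀ : ℕ, ∀ m : ℕ, N₀ ≤ m + 1 → ∀ L : ℝ, 0 < L → ((m + 1 : ℕ) : ℝ) ≤ ρ₀ * L ^ 3 → ∀ n : Fin 3 → ℤ, n ≠ 0 → 2 * Real.pi * ‖(fun j => (n j : ℝ))‖ / L ≤ M * Real.sqrt ((m + 1 : ℕ) / L ^ 3) → ∀ Φ : Literature.MathematicalPhysics.QuantumManyBody.BoseGas.PeriodicTrialState (m + 1) L, Literature.MathematicalPhysics.QuantumManyBody.BoseGas.periodicEnergy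 v Φ = Literature.MathematicalPhysics.QuantumManyBody.BoseGas.periodicGroundStateEnergy v (m + 1) L → (∀ X, Φ.ψ X ≠ 0) → let W : Literature.MathematicalPhysics.QuantumManyBody.BoseGas.Config (m + 1) → ℝ := fun X => ∫ y in Literature.MathematicalPhysics.QuantumManyBody.BoseGas.cell L, ‖Φ.ψ (Function.update X 0 y)‖ ^ 2; let ψ : Literature.MathematicalPhysics.QuantumManyBody.BoseGas.Config (m + 1) → ℝ := fun X => ‖Φ.ψ X‖ / Real.sqrt (W X); let β : Literature.MathematicalPhysics.QuantumManyBody.BoseGas.Config (m + 1) → ℂ := fun X => ∫ y in Literature.MathematicalPhysics.QuantumManyBody.BoseGas.cell L, Complex.exp (Complex.I * ↑(2 * Real.pi / L * ∑ j, (n j : ℝ) * y j)) * (ψ (Function.update X 0 y) : ℂ); let q : Literature.MathematicalPhysics.QuantumManyBody.BoseGas.Config (m + 1) → ℂ := fun X => ((Real.sqrt (L ^ 3))⁻¹ : ℂ) * (Complex.exp (Complex.I * ↑(2 * Real.pi / L * ∑ j, (n j : ℝ) * X 0 j)) * (ψ X : ℂ) - β X * (ψ X : ℂ) ^ 2); ∃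 J : Literature.MathematicalPhysics.QuantumManyBody.BoseGas.Config (m + 1) → (Fin 3 → ℂ), (∀ η : Literature.MathematicalPhysics.QuantumManyBody.BoseGas.Config (m + 1) → ℂ, ContDiff ℝ 1 η → (∀ X (i : Fin (m + 1)) (l : Fin 3), η (X + Pi.single i (EuclideanSpace.single l L)) = η X) → ∫ X in Literature.MathematicalPhysics.QuantumManyBody.BoseGas.cellN (m + 1) L, ∑ l : Fin 3, J X l * fderiv ℝ η X (Pi.single 0 (EuclideanSpace.single l (1 : ℝ))) = - ∫ X in Literature.MathematicalPhysics.QuantumManyBody.BoseGas.cellN (m + 1) L, q X * η X) ∧ ∫⁻ X in Literature.MathematicalPhysics.QuantumManyBody.BoseGas.cellN (m + 1) L, ENNReal.ofReal ((∑ l : Fin 3, ‖J X l‖ ^ 2) * W X / ψ X ^ 2) ≤ ENNReal.ofReal (C * L ^ 2 / ‖(fun j => (n j : ℝ))‖ ^ 2)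

/-- item stmt-AtomisticToContinuum-9481 · crux · rank 4 · open · by planner
why it might fail: The s→0 end is a true curvature (compressibility) floor χ_ρρ(k) ≤ 2CN/(k²+ρa) uniformly down to k = 2π/L: LHY-precision asymptotics control E₀(s) only for s ≳ ρa(ρa³)^{1/4}; below, anomalously soft low-k density weight is excluded by no printed method (spectra known only in mean-field/GP scalings).
sources: FournaisSolovej2020, FournaisSolovej2022, Feynman1954, PitaevskiiStringari1991, Stringari1995, Seiringer2011
[crux] (audit-14's hidden hypothesis made explicit; the same statement as card
kv-insertion-corrector's K1 StaticResponseBound) density-channel chord bound at compressibility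
level: ∀ v ∀ M ∃ ρ₀ C N₀ ∀ N ≥ N₀ ∀ L (N ≤ ρ₀L³) ∀ n ≠ 0 in the window ∀ s ≥ 0 ∀ Φ: E₀^per + s|∫
(Σ_i 2cos(k·x_i))|Φ|²| ≤ periodicEnergy Φ + C s² N/(k² + (N/L³)·a), a = scattering length of v
(toReal; 0 for v = 0, where the free value χ/N = 2/k² shows the form is sharp); i.e. χ_ρρ(k) ≤
2CN/(k² + ρa) — Feynman single-mode saturation up to constants (Bogoliubov: 2N/(k² + 16πρa)),
uniformly down to k = 2π/L. [difficulty: open-problem] -/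
@[route_item "route-AtomisticToContinuum-BECThomsonPrinciple"]
def DensityResponse : Prop :=
  ∀ v : ℝ → ENNReal, Literature.MathematicalPhysics.QuantumManyBody.BoseGas.IsRepulsiveFiniteRange v → ∀ M : ℝ, 0 < M → ∃ ρ₀ C : ℝ, 0 < ρ₀ ∧ 0 < C ∧ ∃ N₀ : ℕ, ∀ N : ℕ, N₀ ≤ N → ∀ L : ℝ, 0 < L → (N : ℝ) ≤ ρ₀ * L ^ 3 → ∀ n : Fin 3 → ℤ, n ≠ 0 → 2 * Real.pi * ‖(fun j => (n j : ℝ))‖ / L ≤ M * Real.sqrt (N / L ^ 3) → ∀ s : ℝ, 0 ≤ s → ∀ Φ : Literature.MathematicalPhysics.QuantumManyBody.BoseGas.PeriodicTrialState N L, Literature.MathematicalPhysics.QuantumManyBody.BoseGas.periodicGroundStateEnergy v N L + ENNReal.ofReal (s * |∫ X in Literature.MathematicalPhysics.QuantumManyBody.BoseGas.cellN N L, (∑ i, 2 * Real.cos (2 * Real.pi / L * ∑ j, (n j : ℝ) * X i j)) * ‖Φ.ψ X‖ ^ 2|) ≤ Literature.MathematicalPhysics.QuantumManyBody.BoseGas.periodicEnergy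 v Φ + ENNReal.ofReal (C * s ^ 2 * N / ((2 * Real.pi * ‖(fun j => (n j : ℝ))‖ / L) ^ 2 + N / L ^ 3 * (Literature.MathematicalPhysics.QuantumManyBody.BoseGas.scatteringLength v).toReal))

/-- item stmt-AtomisticToContinuum-9482 · crux · rank 5 · open · by planner
why it might fail: Verbatim KLS variation Ψ+tζ, ζ=(Λ_k+Λ_k†)Ψ, is void for hard cores (admissible v): the cell average P_i smears the core zero set, periodicEnergy(Ψ+tζ)=⊤ and GDCan says nothing; a contact cutoff F with [H,F] error O(ρa)‖ζ‖² is unprinted; near-minimisers add O(√δ) terms; cell Parseval/Λ†Λ=n_k unbuilt.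
sources: KennedyLiebShastry1988, KLS1988JSP, arXiv:1211.2778, LSSY2005, PitaevskiiStringari1991, Literature.MathematicalPhysics.QuantumLattice.kennedy_lieb_shastry_xy_ground_of_gaussianDomination
[crux] GDCan → PeriodicBEC (PeriodicBEC verbatim = BECPeriodicReduction.PeriodicBEC; GDCan inlined
as the antecedent). Mechanism: T = 0 Kennedy–Lieb–Shastry run variationally with Φ_t = Ψ + tζ, ζ =
(Λ_k^θ + Λ_k^θ†)Ψ, for a δ-near-minimiser Ψ: GDCan at (s,t) with s = t‖ζ‖²k²/C gives ‖ζ‖⁴ ≤ C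
c_k/k², c_k = second variation of the energy form at ζ ≤ 2(k² + C'ρ), while ‖ζ‖² ≥ ⟨Ψ, n̂_k Ψ⟩ (Λ†Λ
= n̂_k); hence n_k ≤ √(2C)(1 + √(C'ρ)/k) in the window, Σ_window n_k = O(√C M³ √ρ N), kinetic
Chebyshev above the window Σ_(|k|>M√ρ) n_k ≤ (E₀+δ)/(M²ρ) ≤ 4πaN(1+o(1))/M² (Dyson's bound, support
UpperBoundPeriodic), Parseval on the cell ⇒ ⟨Ψ, n̂₀Ψ⟩ ≥ (1 − 4πa/M² − O(M³√(ρa³)))N; choose M then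
ρ₀. [deps: GaussianDominationCan] [difficulty: L] -/
@[route_item "route-AtomisticToContinuum-BECThomsonPrinciple", crux]
def GDTransfer : Prop :=
  (∀ v : ℝ → ENNReal, Literature.MathematicalPhysics.QuantumManyBody.BoseGas.IsRepulsiveFiniteRange v → ∀ M : ℝ, 0 < M → ∃ ρ₀ C : ℝ, 0 < ρ₀ ∧ 0 < C ∧ ∃ N₀ : ℕ, ∀ m : ℕ, N₀ ≤ m + 1 → ∀ L : ℝ, 0 < L → ((m + 1 : ℕ) : ℝ) ≤ ρ₀ * L ^ 3 → ∀ n : Fin 3 → ℤ, n ≠ 0 → 2 * Real.pi * ‖(fun j => (n j : ℝ))‖ / L ≤ M * Real.sqrt ((m + 1 : ℕ) / L ^ 3) → ∀ s : ℝ, 0 ≤ s → ∀ Φ : Literature.MathematicalPhysics.QuantumManyBody.BoseGas.PeriodicTrialState (m + 1) L, let P : Fin (m + 1) → (Literature.MathematicalPhysics.QuantumManyBody.BoseGas.Config (m + 1) → ℂ) → (Literature.MathematicalPhysics.QuantumManyBody.BoseGas.Config (m + 1) → ℂ) := fun i g X => ((L ^ 3)⁻¹ : ℝ) • ∫ y in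 Literature.MathematicalPhysics.QuantumManyBody.BoseGas.cell L, g (Function.update X i y); let Q : Finset (Fin (m + 1)) → (Literature.MathematicalPhysics.QuantumManyBody.BoseGas.Config (m + 1) → ℂ) → (Literature.MathematicalPhysics.QuantumManyBody.BoseGas.Config (m + 1) → ℂ) := fun S g => (List.finRange (m + 1)).foldr (fun i h => if i ∈ S then P i h else h - P i h) g; let Θ : Literature.MathematicalPhysics.QuantumManyBody.BoseGas.Config (m + 1) → ℂ := fun X => ∑ S ∈ (Finset.univ : Finset (Finset (Fin (m + 1)))).filter (fun S => (0 : Fin (m + 1)) ∈ S), ((Real.sqrt (S.card : ℝ))⁻¹ : ℂ) * Q S Φ.ψ X; Literature.MathematicalPhysics.QuantumManyBody.BoseGas.periodicGroundStateEnergy v (m + 1) L + ENNReal.ofReal (s * (2 * (m + 1) * ‖∫ X in Literature.MathematicalPhysics.QuantumManyBody.BoseGas.cellN (m + 1) L, (starRingEnd ℂ) (Φ.ψ X) * Complex.exp (Complex.I * ↑(2 * Real.pi / L * ∑ j, (n j : ℝ) * X 0 j)) * Θ X‖)) ≤ Literature.MathematicalPhysics.QuantumManyBody.BoseGas.periodicEnergy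 v Φ + ENNReal.ofReal (C * s ^ 2 * L ^ 2 / ‖(fun j => (n j : ℝ))‖ ^ 2)) → ∀ v : ℝ → ENNReal, Literature.MathematicalPhysics.QuantumManyBody.BoseGas.IsRepulsiveFiniteRange v → ∃ ρ₀ : ℝ, 0 < ρ₀ ∧ ∀ ρ : ℝ, 0 < ρ → ρ < ρ₀ → ∃ c : ℝ, 0 < c ∧ ∀ᶠ N : ℕ in Filter.atTop, ∃ δ : ENNReal, 0 < δ ∧ ∀ Ψ : Literature.MathematicalPhysics.QuantumManyBody.BoseGas.PeriodicTrialState N (Literature.MathematicalPhysics.QuantumManyBody.BoseGas.sideLength ρ N), Literature.MathematicalPhysics.QuantumManyBody.BoseGas.periodicEnergy v Ψ ≤ Literature.MathematicalPhysics.QuantumManyBody.BoseGas.periodicGroundStateEnergy v N (Literature.MathematicalPhysics.QuantumManyBody.BoseGas.sideLength ρ N) + δ → ENNReal.ofReal (c * N) ≤ Literature.MathematicalPhysics.QuantumManyBody.BoseGas.condensateOccupation N (Literature.MathematicalPhysics.QuantumManyBody.BoseGas.sideLength ρ N) Ψ.ψ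

/-- item stmt-AtomisticToContinuum-9483 · crux · rank 6 · open · by planner
why it might fail: No condensate-fraction transfer periodic→Dirichlet in print/tree — only ENERGY transfers (LSSY2005_e0_periodic_eq_dirichlet_offCritical; BCS2021 Lem A.1 exists_dirichlet_le_periodic, shifting L→L(1+1/M)); wall term ≫ near-minimiser slack δ bars energy comparison; BEC is b.c.-sensitive (Robinson1976)
sources: LSSY2005, Robinson1976, BastiCenatiempoSchlein2021, BoccatoSeiringer2023, Junge2026, arXiv:2510.20493
[crux] (global form of route BECPeriodicReduction's BoundaryTransferWeak =
stmt-AtomisticToContinuum-0827, from which it follows by `fun h hP v hv => h v hv (hP v hv)`; filed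
as this route's own decl so that the Assembly can name it) PeriodicBEC ⇒ BoseEinsteinCondensation:
if for every repulsive finite-range v the δ-near-minimisers of the PERIODIC energy on the torus of
side (N/ρ)^(1/3) have constant-mode occupation ≥ cN at all small densities (the consequent of
GDTransfer, verbatim), then the audited Dirichlet, mode-free conjunct holds (λ_max of γ of the
Dirichlet ground state ≥ cN via condensateNumber, all small ρ, every such v). [deps: GDTransfer]
[difficulty: L] -/
@[route_item "route-AtomisticToContinuum-BECThomsonPrinciple", crux]
def PeriodicToDirichlet : Prop :=
  (∀ v : ℝ → ENNReal, Literature.MathematicalPhysics.QuantumManyBody.BoseGas.IsRepulsiveFiniteRange v → ∃ ρ₀ : ℝ, 0 < ρ₀ ∧ ∀ ρ : ℝ, 0 < ρ → ρ < ρ₀ → ∃ c : ℝ, 0 < c ∧ ∀ᶠ N : ℕ in Filter.atTop, ∃ δ : ENNReal, 0 < δ ∧ ∀ Ψ : Literature.MathematicalPhysics.QuantumManyBody.BoseGas.PeriodicTrialState N (Literature.MathematicalPhysics.QuantumManyBody.BoseGas.sideLength ρ N), Literature.MathematicalPhysics.QuantumManyBody.BoseGas.periodicEnergy v Ψ ≤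 Literature.MathematicalPhysics.QuantumManyBody.BoseGas.periodicGroundStateEnergy v N (Literature.MathematicalPhysics.QuantumManyBody.BoseGas.sideLength ρ N) + δ → ENNReal.ofReal (c * N) ≤ Literature.MathematicalPhysics.QuantumManyBody.BoseGas.condensateOccupation N (Literature.MathematicalPhysics.QuantumManyBody.BoseGas.sideLength ρ N) Ψ.ψ) → _root_.BoseEinsteinCondensation

/-- item stmt-AtomisticToContinuum-14102 · support · rank 9 · closed · proved by Summit.AtomisticToContinuum.BoseEinsteinCondensation.Theorems.BECThomsonPrinciple.targetOfCruxes_proof @ 675606b0281c (prover) · by planner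
[support] glue (route-choice repair 2026-08-16, target-unreachable): the three assembly cruxes give
the Target — GaussianDominationCan → GDTransfer → PeriodicToDirichlet → Target. Target is rfl-equal
to GaussianDominationCan ∧ GDTransfer ∧ PeriodicToDirichlet (its three conjuncts are the same terms
written under a term-level `open … in`), so the proof is the one-liner `fun hG hT hP => ⟨hG, hT,
hP⟩` (checked rc 0 in the planner's Sketch.lean, together with `example : Target =
(GaussianDominationCan ∧ GDTransfer ∧ PeriodicToDirichlet) := rfl`). Pure logic, no mathematics;
closable by any idle prover. Sources: LSSY2005, KennedyLiebShastry1988 (as for Assembly). -/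
@[route_item "route-AtomisticToContinuum-BECThomsonPrinciple"]
def TargetOfCruxes : Prop :=
  GaussianDominationCan → GDTransfer → PeriodicToDirichlet → Target

/-- item stmt-AtomisticToContinuum-14723 · support · rank 9 · open · by planner
why it might fail: Carries GDCan's closure problem (two-phonon remainder in H⁻¹(Ψ₀²), crude bounds ~ log(L/ξ)); hard cores not fed by the hypotheses (FibreConductance bounded-v only, v-dependent constants); chord form ∀s ∀Φ is an operator inequality beyond 2nd order; vacuous if FibreConductance refuted.
sources: doi:10.1063/1.1734192, LyonsPeres2016, DysonLiebSimon1978, KennedyLiebShastry1988, PitaevskiiStringari1991, Stringari1995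
[support] glue of the flow mechanism (route-repair 2026-08-16, unused-crux): FibreConductance →
DensityResponse → GaussianDominationCan — the thesis' recipe (“GDCan by Thomson's principle for the
ground-state Dirichlet form: fibre flows = FibreConductance, bath charge = density channel =
DensityResponse”) filed as an item, so that both mechanism cruxes feed the `closes` hypothesis
GaussianDominationCan (which stays directly claimable; `closes` is unchanged). Content, for an exact
positive minimiser Ψ₀ at fixed (N, L) and k in the window: (i) ground-state representation + Thomson
duality, χ_Λ/2 = ‖(Λ_kΨ₀)Ψ₀‖²_{H⁻¹(Ψ₀²)} ≤ ∫|J|²/Ψ₀² for ONE flow J with div J = the Λ_k-charge;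
(ii) J = the fibre flows of FibreConductance (re-weighted from the charge e^{ik·x₀}ψ to the
Λ_k-charge, coefficients P_i n̂₀^{-1/2}Ψ₀) plus a bath flow for the fibre-averaged residual charge
−(1−S(k))/(2S(k)N)·ρ_kΨ₀² + two-phonon remainder, costed by DensityResponse (χ_ρρ(k) ≤ 2CN/(k²+ρa))
and the moment floor S(k) ≥ k/c₃ (m₃ finite for smooth v); (iii) from the curvature bound at s = 0
to the chord inequality for every s ≥ 0 and every trial Φ (large s free, ‖Λ_k‖ ≤ √N); (iv) existence
of exact zero-free minimis -/
@[route_item "route-AtomisticToContinuum-BECThomsonPrinciple"]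
def GDCanOfFlows : Prop :=
  FibreConductance → DensityResponse → GaussianDominationCan

-- earlier Assembly (stmt-AtomisticToContinuum-14474, replaced 2026-08-16T03:37:12Z -> stmt-AtomisticToContinuum-14591): retired by None — GaussianDominationCan → _root_.BoseEinsteinCondensation
-- earlier Assembly (stmt-AtomisticToContinuum-14591, replaced 2026-08-16T03:46:15Z -> stmt-AtomisticToContinuum-14549): retired by None — Target → _root_.BoseEinsteinCondensation
-- earlier Assembly (stmt-AtomisticToContinuum-9485, replaced 2026-08-16T03:28:33Z -> stmt-AtomisticToContinuum-14474): retired by None — GaussianDominationCan → GDTransfer → PeriodicToDirichlet → _root_.BoseEinsteinCondensation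
/-- item stmt-AtomisticToContinuum-14549 · assembly · rank 1 · open · by planner
sources: LSSY2005, KennedyLiebShastry1988
[assembly] sufficiency of the spine crux: GaussianDominationCan → BoseEinsteinCondensation —
canonical T = 0 Gaussian domination on the torus (LNSS excitation source, chord form) implies the
audited Dirichlet conjunct ("it suffices to show GDCan"). Follows from the transfer cruxes by `fun
hT hP hG => hP (hT hG)` (GDTransfer: GDCan → PeriodicBEC by variational T = 0 Kennedy–Lieb–Shastry;
PeriodicToDirichlet: PeriodicBEC → BEC), so it closes when they close (or directly); the deciding
theorem `closes : GaussianDominationCan → GDTransfer → PeriodicToDirichlet →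
BoseEinsteinCondensation` keeps the full chain. History: the original Assembly (stmt-9485) was that
tautological chain and was flagged ground.trivial (`tauto`) by the h21 ground audit; restated to
this form by the route-choice seat (stmt-14474, 2026-08-16T03:28Z, ground OK 03:33Z); a concurrent
ground-repair edit (stmt-14591, frame form Target → BoseEinsteinCondensation, 03:37Z) overwrote it
unintentionally and is hereby reverted to the route-choice statement, verbatim. Both forms pass the
ground battery (planner rig: HarnessLib.Audit.groundCore at default and 25× budget, no flags).
Sources: KennedyLiebShastry1988, LSSY2005, ar -/
@[route_item "route-AtomisticToContinuum-BECThomsonPrinciple"]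
def Assembly : Prop :=
  GaussianDominationCan → _root_.BoseEinsteinCondensation

/-! D-0027 §2.1 — DECIDING THEOREM (planner-authored via `route open/edit --closes-file`; by planner-plancard-AtomisticToContinuum-BoseEin-e92e37bd-0 2026-08-15T13:58:17Z):
its hypotheses are this route's items and its conclusion the sub-problem Statement (glue_lint), and it elaborates with this file. -/

@[closes "route-AtomisticToContinuum-BECThomsonPrinciple"] theorem closes : GaussianDominationCan → GDTransfer → PeriodicToDirichlet → BoseEinsteinCondensation :=
  fun hG hT hP => hP (hT hG)

end Summit.AtomisticToContinuum.BoseEinsteinCondensation.Theses.BECThomsonPrinciple
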